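import Summits.AtomisticToContinuum.FouriersLaw.Theses.PhononMeanFreePath
import Summits.AtomisticToContinuum.FouriersLaw.Theorems.BoundaryKubo.Negative.LoadBearing
import Summits.AtomisticToContinuum.FouriersLaw.Theorems.PhononMeanFreePathBoundaryKuboSumRuleAux1
import Summits.AtomisticToContinuum.FouriersLaw.Theorems.PhononMeanFreePathBoundaryKuboGibbsTTCFAux2

/-!
# Equilibrium sum rule, helper 2: the energy-tested Dynkin identity `μ₀(H·K_S A) - μ₀(HA) = ∫₀^S μ₀((LH)·K_s A) ds`
(helpers for stub `stub_sumRule` of line `gibbs-ttcf`, crux stmt-AtomisticToContinuum-11812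
`PhononMeanFreePath.BoundaryKubo`)

For the pinned anharmonic chain `P = pinnedChain ω₂ lam β γ` (`ω₂ > 0`, `lam, β, γ ≥ 0`) with `N + 1` sites `0..N`,
both baths at `T > 0`, Gibbs weight `ρ = e^{-H/T}`, Gibbs measure `μ₀ = gibbsMeasure (N+1) T`, the CONSTRUCTED kernels
`K_s = transitionKernel (N+1) T T s`, `A = p_N²` and `LH = γ(2T - p_0² - p_N²)` (the forward generator of the energy):

* `pinnedChain_sumRule_density` — `∫ H (K_S A) ρ dx - ∫ H A ρ dx = ∫₀^S ∫ (LH) (K_s A) ρ dx ds` (`S ≥ 0`);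
* `pinnedChain_sumRule_gibbs` / `sumRule_energyIdentity` (registered sub-goal) — the same for `μ₀`.

This is Dynkin's formula for the energy in the FIRST slot of the equilibrium two-time correlation, i.e. for the
`μ₀`-adjoint semigroup, obtained WITHOUT kernel detailed balance: Lebesgue duality of the Langevin kernels
`∫ wρ (K_s f) dx = e^{2γs} ∫ f · P̂_s(wρ) dy` (`pinnedChain_gibbs_duality`, `P̂` the anti-friction reversed kernels) for
`w ∈ {H, LH}`, the Doob–Dynkin identity `e^{2γS} P̂_S(Hρ) - Hρ = ∫₀^S e^{2γs} P̂_s((LH)ρ) ds`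
(`gibbsDensityH_langevinRevKernel_identity`, helper 1), and Fubini in `(s, y)` (joint measurability of the reversed
kernels, integrability from CEHR (3.4) and `e^{H/(2T)}ρ ∈ L¹`) — the engine of `stub_gibbsTTCF` with the weight `H`.
-/

noncomputable section

open scoped NNReal ENNReal Topology
open MeasureTheory Filter Set

namespace Summit.AtomisticToContinuum.FouriersLaw.Theorems.BoundaryKubo.GibbsTtcf

open Literature.MathematicalPhysics.KineticTheory.HeatConduction
open Literature.MathematicalPhysics.KineticTheory Literature.Probability.Process OscillatorChain
open ProbabilityTheory
open Summit.AtomisticToContinuum.FouriersLaw.Theorems.SubdiffusiveBondHeat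

/-- **The energy-tested Dynkin identity for the un-normalised Gibbs weight** `ρ = e^{-H/T}` of the pinned chain
(`ω₂ > 0`, `lam, β, γ ≥ 0`, `N + 1` sites, both baths at `T > 0`, `S ≥ 0`), `K_s = transitionKernel (N+1) T T s`,
`A = p_N²`: `∫ H (K_S A) ρ dx - ∫ H A ρ dx = ∫₀^S ∫ γ(2T - p_0² - p_N²) (K_s A) ρ dx ds`, i.e.
`μ₀(H · K_S A) - μ₀(H A) = ∫₀^S μ₀((LH) · K_s A) ds` with `LH = γ(2T - p_0² - p_N²)` — WITHOUT kernel detailed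
balance: Lebesgue duality `∫ wρ (K_s f) dx = e^{2γs} ∫ f P̂_s(wρ) dy` (`pinnedChain_gibbs_duality`) for `w ∈ {H, LH}`
and the Doob–Dynkin identity for the energy along the reversed equation (`gibbsDensityH_langevinRevKernel_identity`),
Fubini in `(s, y)`. [folklore] -/
theorem pinnedChain_sumRule_density {ω₂ lam β γ : ℝ} (hω : 0 < ω₂) (hl : 0 ≤ lam) (hβ : 0 ≤ β) (hγ : 0 ≤ γ)
    (N : ℕ) {T : ℝ} (hT : 0 < T) {S : ℝ} (hS : 0 ≤ S) :
    (∫ x, (pinnedChain ω₂ lam β γ).hamiltonian (N + 1) x * (∫ y, (y.2 (Fin.last N)) ^ 2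
        ∂((pinnedChain ω₂ lam β γ).transitionKernel (N + 1) T T S.toNNReal x)) *
        (pinnedChain ω₂ lam β γ).gibbsDensity (N + 1) T x) -
      ∫ x, (pinnedChain ω₂ lam β γ).hamiltonian (N + 1) x * (x.2 (Fin.last N)) ^ 2 *
        (pinnedChain ω₂ lam β γ).gibbsDensity (N + 1) T x =
    ∫ s in (0 : ℝ)..S,
      ∫ x, γ * (2 * T - ((x.2 0) ^ 2 + (x.2 (Fin.last N)) ^ 2)) * (∫ y, (y.2 (Fin.last N)) ^ 2
        ∂((pinnedChain ω₂ lam β γ).transitionKernel (N + 1) T T s.toNNReal x)) *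
        (pinnedChain ω₂ lam β γ).gibbsDensity (N + 1) T x := by
  -- notation
  set P := pinnedChain ω₂ lam β γ with hPdef
  have hP : P.IsConfining := pinnedChain_isConfining hω hl hβ hγ
  have hM : 0 < N + 1 := Nat.succ_pos N
  set ρ := P.gibbsDensity (N + 1) T with hρdef
  set Hm := P.hamiltonian (N + 1) with hHm
  set A : PhaseSpace (N + 1) → ℝ := fun y => (y.2 (Fin.last N)) ^ 2 with hA
  set W : PhaseSpace (N + 1) → ℝ := fun x => γ * (2 * T - ((x.2 0) ^ 2 + (x.2 (Fin.last N)) ^ 2)) with hW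
  set K : ℝ≥0 → Kernel (PhaseSpace (N + 1)) (PhaseSpace (N + 1)) := P.transitionKernel (N + 1) T T with hK
  set Kr : ℝ≥0 → Kernel (PhaseSpace (N + 1)) (PhaseSpace (N + 1)) := P.langevinRevKernel (N + 1) T T with hKr
  show (∫ x, Hm x * (∫ y, A y ∂(K S.toNNReal x)) * ρ x) - ∫ x, Hm x * A x * ρ x =
    ∫ s in (0:ℝ)..S, ∫ x, W x * (∫ y, A y ∂(K s.toNNReal x)) * ρ x
  -- the exponent `θ = 1/(4T)`
  set θ : ℝ := 1 / (4 * T) with hθ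
  have hθ0 : 0 < θ := by positivity
  have hθ' : θ < 1 / max T T := by
    rw [max_self, hθ]; exact one_div_lt_one_div_of_lt hT (by linarith)
  have h2θ : 2 * θ < 1 / T := by
    rw [hθ, show 2 * (1 / (4 * T)) = 1 / (2 * T) by field_simp; ring]
    exact one_div_lt_one_div_of_lt hT (by linarith)
  have hθ1 : θ < 1 / T := by linarith
  -- continuity and exponential bounds of `A`, `W`, `H`
  have hAc : Continuous A := by rw [hA]; fun_prop
  have hWc : Continuous W := by rw [hW]; fun_prop
  have hHc : Continuous Hm := pinnedChain_continuous_hamiltonian ω₂ lam β γ (N + 1)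
  have hρc : Continuous ρ := pinnedChain_continuous_gibbsDensity ω₂ lam β γ (N + 1) T
  have hρ0 : ∀ x, 0 ≤ ρ x := fun x => (P.gibbsDensity_pos (N + 1) T x).le
  have hH0 : ∀ x, 0 ≤ Hm x := fun x => hP.hamiltonian_nonneg (N + 1) x
  have hA0 : ∀ y, 0 ≤ A y := fun y => sq_nonneg _
  have hsq : ∀ (y : PhaseSpace (N + 1)) (i : Fin (N + 1)),
      |y.2 i ^ 2| ≤ 2 / θ * Real.exp (θ * Hm y) := abs_sq_momentum_le_exp hP hθ0 (N + 1)
  have hAb : ∀ y, |A y| ≤ 2 / θ * Real.exp (θ * Hm y) := fun y => hsq y _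
  have hE1 : ∀ x, 1 ≤ Real.exp (θ * Hm x) := fun x => Real.one_le_exp (mul_nonneg hθ0.le (hH0 x))
  have hWb : ∀ x, |W x| ≤ γ * (2 * T + 4 / θ) * Real.exp (θ * Hm x) := fun x => by
    have h1 : |(x.2 0) ^ 2 + (x.2 (Fin.last N)) ^ 2| ≤ 4 / θ * Real.exp (θ * Hm x) :=
      calc |(x.2 0) ^ 2 + (x.2 (Fin.last N)) ^ 2| ≤ |x.2 0 ^ 2| + |x.2 (Fin.last N) ^ 2| := abs_add_le _ _
        _ ≤ 2 / θ * Real.exp (θ * Hm x) + 2 / θ * Real.exp (θ * Hm x) := add_le_add (hsq x _) (hsq x _)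
        _ = 4 / θ * Real.exp (θ * Hm x) := by ring
    rw [hW, abs_mul, abs_of_nonneg hγ, mul_assoc]
    refine mul_le_mul_of_nonneg_left ((abs_sub _ _).trans ?_) hγ
    rw [abs_of_pos (by positivity : (0:ℝ) < 2 * T), add_mul]
    exact add_le_add (by nlinarith [hE1 x]) h1
  have hHb : ∀ x, |Hm x| ≤ 1 / θ * Real.exp (θ * Hm x) := fun x => by
    rw [abs_of_nonneg (hH0 x), div_mul_eq_mul_div, le_div_iff₀ hθ0, one_mul]
    nlinarith [Real.add_one_le_exp (θ * Hm x)]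
  -- the case `S = 0`: both sides vanish
  obtain rfl | hS0 := hS.eq_or_lt
  · have hK0 : K (Real.toNNReal 0) = Kernel.id := by
      rw [Real.toNNReal_zero]; exact pinnedChain_transitionKernel_zero hω hl hβ hγ (N + 1) _ _
    rw [hK0, intervalIntegral.integral_same]
    simp only [Kernel.id_apply, integral_dirac, sub_self]
  -- the case `S > 0`
  set Sn := S.toNNReal with hSn
  have hSn0 : 0 < Sn := Real.toNNReal_pos.2 hS0
  have hSnc : ((Sn : ℝ≥0) : ℝ) = S := Real.coe_toNNReal _ hS
  set Φ : PhaseSpace (N + 1) → ℝ := fun y => ∫ x, Hm x * ρ x ∂(Kr Sn y) with hΦ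
  set Ψ : ℝ → PhaseSpace (N + 1) → ℝ := fun s y => ∫ x, W x * ρ x ∂(Kr s.toNNReal y) with hΨ
  -- (a) duality at time `S` with `w = H`
  obtain ⟨hi1, -, hd1⟩ := pinnedChain_gibbs_duality hω hl hβ hγ hM hT hT hT hθ0 hθ' h2θ hHc hAc hHb hAb hSn0
  rw [hSnc] at hd1
  have hLHS : ∫ x, Hm x * (∫ y, A y ∂(K Sn x)) * ρ x = Real.exp (2 * γ * S) * ∫ y, A y * Φ y :=
    calc ∫ x, Hm x * (∫ y, A y ∂(K Sn x)) * ρ x = ∫ x, Hm x * ρ x * ∫ y, A y ∂(K Sn x) :=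
          integral_congr_ae (Eventually.of_forall fun x => by ring)
      _ = Real.exp (2 * γ * S) * ∫ y, A y * Φ y := hd1
  -- (b) the pointwise Doob–Dynkin identity for the energy under the reversed kernels
  have hpt : ∀ y, Real.exp (2 * γ * S) * Φ y - Hm y * ρ y = ∫ s in (0:ℝ)..S, Real.exp (2 * γ * s) * Ψ s y :=
    fun y => gibbsDensityH_langevinRevKernel_identity hP hM hT hS y
  -- (c) integrate against `A(y) dy`
  have hwt1 : Integrable (fun x => Real.exp (θ * Hm x) * ρ x) :=
    pinnedChain_integrable_exp_mul_gibbsDensity hω hl hβ γ (N + 1) hT hθ1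
  have hwt2 : Integrable (fun x => Real.exp (2 * θ * Hm x) * ρ x) :=
    pinnedChain_integrable_exp_mul_gibbsDensity hω hl hβ γ (N + 1) hT h2θ
  have hAHρ : Integrable (fun y => Hm y * A y * ρ y) :=
    (hwt2.const_mul (1 / θ * (2 / θ))).mono' ((hHc.mul hAc).mul hρc).aestronglyMeasurable
      (Eventually.of_forall fun y => by
        rw [Real.norm_eq_abs, abs_mul, abs_mul, abs_of_nonneg (hρ0 y), ← mul_assoc]
        refine mul_le_mul_of_nonneg_right ?_ (hρ0 y)
        calc |Hm y| * |A y| ≤ (1 / θ * Real.exp (θ * Hm y)) * (2 / θ * Real.exp (θ * Hm y)) :=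
              mul_le_mul (hHb y) (hAb y) (abs_nonneg _) (by positivity)
          _ = 1 / θ * (2 / θ) * Real.exp (2 * θ * Hm y) := by
              rw [show 2 * θ * Hm y = θ * Hm y + θ * Hm y by ring, Real.exp_add]; ring)
  have hAΦ : Integrable (fun y => A y * Φ y) :=
    hi1.congr (Eventually.of_forall fun y => by
      show |A y| * (∫ x, |Hm x| * ρ x ∂(Kr Sn y)) = A y * Φ y
      rw [abs_of_nonneg (hA0 y)]
      exact congrArg _ (integral_congr_ae (Eventually.of_forall fun x => by
        show |Hm x| * ρ x = Hm x * ρ x; rw [abs_of_nonneg (hH0 x)])))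
  have hstep : (∫ x, Hm x * (∫ y, A y ∂(K Sn x)) * ρ x) - ∫ x, Hm x * A x * ρ x =
      ∫ y, ∫ s in (0:ℝ)..S, A y * (Real.exp (2 * γ * s) * Ψ s y) := by
    have e : ∀ y, Real.exp (2 * γ * S) * (A y * Φ y) - Hm y * A y * ρ y =
        ∫ s in (0:ℝ)..S, A y * (Real.exp (2 * γ * s) * Ψ s y) := by
      intro y
      rw [intervalIntegral.integral_const_mul, ← hpt y]; ring
    rw [hLHS, ← integral_const_mul (Real.exp (2 * γ * S)), ← integral_sub (hAΦ.const_mul _) hAHρ]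
    exact integral_congr_ae (Eventually.of_forall e)
  -- (d) duality at the times `s > 0` with `w = W`
  have hdu : ∀ s : ℝ, 0 < s →
      Integrable (fun y => |A y| * ∫ x, |W x| * ρ x ∂(Kr s.toNNReal y)) ∧
      (∫ y, |A y| * ∫ x, |W x| * ρ x ∂(Kr s.toNNReal y)) ≤ Real.exp (-(2 * γ * s)) *
        (γ * (2 * T + 4 / θ) * (2 / θ) * Real.exp (θ * γ * (T + T) * s) *
          ∫ x, Real.exp (2 * θ * Hm x) * ρ x) ∧
      ∫ x, W x * ρ x * (∫ y, A y ∂(K s.toNNReal x)) = Real.exp (2 * γ * s) * ∫ y, A y * Ψ s y := by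
    intro s hs
    have h := pinnedChain_gibbs_duality hω hl hβ hγ hM hT hT hT hθ0 hθ' h2θ hWc hAc hWb hAb
      (Real.toNNReal_pos.2 hs)
    rwa [Real.coe_toNNReal _ hs.le] at h
  -- (e) joint measurability of `(s, y) ↦ Ψ s y` and integrability of `G` on `(0, S] × Ω`
  have hΨm : StronglyMeasurable fun q : ℝ × PhaseSpace (N + 1) => Ψ q.1 q.2 :=
    stronglyMeasurable_integral_langevinRevKernel hP (N + 1) T T (hWc.mul hρc).stronglyMeasurable
  set G : ℝ → PhaseSpace (N + 1) → ℝ := fun s y => A y * (Real.exp (2 * γ * s) * Ψ s y) with hG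
  have hGm : StronglyMeasurable (Function.uncurry G) := by
    have h1 : StronglyMeasurable fun q : ℝ × PhaseSpace (N + 1) => A q.2 :=
      (hAc.comp continuous_snd).stronglyMeasurable
    have h2 : StronglyMeasurable fun q : ℝ × PhaseSpace (N + 1) => Real.exp (2 * γ * q.1) :=
      (Real.continuous_exp.comp ((continuous_const.mul continuous_id).comp continuous_fst)).stronglyMeasurable
    exact h1.mul (h2.mul hΨm)
  set I₂ := ∫ x, Real.exp (2 * θ * Hm x) * ρ x with hI₂
  set Bd := γ * (2 * T + 4 / θ) * (2 / θ) * Real.exp (θ * γ * (T + T) * S) * I₂ with hBd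
  have hGs : ∀ s : ℝ, 0 < s → s ≤ S → Integrable (G s) ∧ ∫ y, ‖G s y‖ ≤ Bd := by
    intro s hs hsS
    obtain ⟨hi, hbd, -⟩ := hdu s hs
    have hΨs : StronglyMeasurable (Ψ s) :=
      (hWc.mul hρc).stronglyMeasurable.integral_kernel (κ := Kr s.toNNReal)
    have hptw : ∀ y, ‖G s y‖ ≤ Real.exp (2 * γ * s) * (|A y| * ∫ x, |W x| * ρ x ∂(Kr s.toNNReal y)) := by
      intro y
      have h1 : ‖Ψ s y‖ ≤ ∫ x, |W x| * ρ x ∂(Kr s.toNNReal y) :=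
        calc ‖Ψ s y‖ ≤ ∫ x, ‖W x * ρ x‖ ∂(Kr s.toNNReal y) := norm_integral_le_integral_norm _
          _ = ∫ x, |W x| * ρ x ∂(Kr s.toNNReal y) := integral_congr_ae (Eventually.of_forall fun x => by
              show ‖W x * ρ x‖ = |W x| * ρ x
              rw [norm_mul, Real.norm_eq_abs, Real.norm_of_nonneg (hρ0 x)])
      show ‖A y * (Real.exp (2 * γ * s) * Ψ s y)‖ ≤ _
      rw [norm_mul, norm_mul, Real.norm_eq_abs, Real.norm_of_nonneg (Real.exp_pos _).le]
      calc |A y| * (Real.exp (2 * γ * s) * ‖Ψ s y‖) = Real.exp (2 * γ * s) * (|A y| * ‖Ψ s y‖) := by ring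
        _ ≤ Real.exp (2 * γ * s) * (|A y| * ∫ x, |W x| * ρ x ∂(Kr s.toNNReal y)) :=
            mul_le_mul_of_nonneg_left (mul_le_mul_of_nonneg_left h1 (abs_nonneg _)) (Real.exp_pos _).le
    have hint : Integrable (G s) := (hi.const_mul (Real.exp (2 * γ * s))).mono'
      (hAc.aestronglyMeasurable.mul ((continuous_const.aestronglyMeasurable).mul hΨs.aestronglyMeasurable))
      (Eventually.of_forall hptw)
    refine ⟨hint, ?_⟩
    have hI₂ : 0 ≤ I₂ := integral_nonneg fun x => mul_nonneg (Real.exp_pos _).le (hρ0 x)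
    have hrate : 0 ≤ θ * γ * (T + T) := mul_nonneg (mul_nonneg hθ0.le hγ) (by linarith)
    calc ∫ y, ‖G s y‖ ≤ ∫ y, Real.exp (2 * γ * s) * (|A y| * ∫ x, |W x| * ρ x ∂(Kr s.toNNReal y)) :=
          integral_mono hint.norm (hi.const_mul _) hptw
      _ = Real.exp (2 * γ * s) * ∫ y, |A y| * ∫ x, |W x| * ρ x ∂(Kr s.toNNReal y) := integral_const_mul _ _
      _ ≤ Real.exp (2 * γ * s) * (Real.exp (-(2 * γ * s)) *
          (γ * (2 * T + 4 / θ) * (2 / θ) * Real.exp (θ * γ * (T + T) * s) * I₂)) :=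
          mul_le_mul_of_nonneg_left hbd (Real.exp_pos _).le
      _ = γ * (2 * T + 4 / θ) * (2 / θ) * Real.exp (θ * γ * (T + T) * s) * I₂ := by
          rw [← mul_assoc, ← Real.exp_add, show 2 * γ * s + -(2 * γ * s) = 0 by ring, Real.exp_zero, one_mul]
      _ ≤ Bd := by
          have hexp : Real.exp (θ * γ * (T + T) * s) ≤ Real.exp (θ * γ * (T + T) * S) :=
            Real.exp_le_exp.2 (mul_le_mul_of_nonneg_left hsS hrate)
          exact mul_le_mul_of_nonneg_right (mul_le_mul_of_nonneg_left hexp (by positivity)) hI₂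
  have hGint : Integrable (Function.uncurry G) ((volume.restrict (Ioc 0 S)).prod volume) := by
    rw [integrable_prod_iff hGm.aestronglyMeasurable]
    constructor
    · exact (ae_restrict_iff' measurableSet_Ioc).2 (Eventually.of_forall fun s hs => (hGs s hs.1 hs.2).1)
    · refine Integrable.of_bound hGm.norm.aestronglyMeasurable.integral_prod_right' Bd ?_
      exact (ae_restrict_iff' measurableSet_Ioc).2 (Eventually.of_forall fun s hs => by
        rw [Real.norm_of_nonneg (integral_nonneg fun y => norm_nonneg _)]
        exact (hGs s hs.1 hs.2).2)
  -- (f) exchange the integrals and use duality backwards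
  rw [hstep]
  calc ∫ y, ∫ s in (0:ℝ)..S, A y * (Real.exp (2 * γ * s) * Ψ s y)
      = ∫ y, ∫ s in Ioc 0 S, G s y :=
        integral_congr_ae (Eventually.of_forall fun y => intervalIntegral.integral_of_le hS)
    _ = ∫ s in Ioc 0 S, ∫ y, G s y := (integral_integral_swap hGint).symm
    _ = ∫ s in Ioc 0 S, ∫ x, W x * (∫ y, A y ∂(K s.toNNReal x)) * ρ x := by
        refine setIntegral_congr_fun measurableSet_Ioc fun s hs => ?_
        obtain ⟨-, -, hd⟩ := hdu s hs.1
        calc ∫ y, G s y = ∫ y, Real.exp (2 * γ * s) * (A y * Ψ s y) :=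
              integral_congr_ae (Eventually.of_forall fun y => by
                show A y * (Real.exp (2 * γ * s) * Ψ s y) = Real.exp (2 * γ * s) * (A y * Ψ s y); ring)
          _ = Real.exp (2 * γ * s) * ∫ y, A y * Ψ s y := integral_const_mul _ _
          _ = ∫ x, W x * ρ x * ∫ y, A y ∂(K s.toNNReal x) := hd.symm
          _ = ∫ x, W x * (∫ y, A y ∂(K s.toNNReal x)) * ρ x :=
              integral_congr_ae (Eventually.of_forall fun x => by
                show W x * ρ x * (∫ y, A y ∂(K s.toNNReal x)) = W x * (∫ y, A y ∂(K s.toNNReal x)) * ρ x; ring)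
    _ = ∫ s in (0:ℝ)..S, ∫ x, W x * (∫ y, A y ∂(K s.toNNReal x)) * ρ x :=
        (intervalIntegral.integral_of_le hS).symm

/-- **The energy-tested Dynkin identity for the Gibbs MEASURE** `μ₀ = gibbsMeasure (N+1) T` of the pinned chain
(`ω₂ > 0`, `lam, β, γ ≥ 0`, `T > 0`, `S ≥ 0`), `K_s = transitionKernel (N+1) T T s`:
`μ₀(H · K_S p_N²) - μ₀(H p_N²) = ∫₀^S μ₀(γ(2T - p_0² - p_N²) · K_s p_N²) ds` (normalise `pinnedChain_sumRule_density`
by the partition function, `integral_gibbsMeasure`). [folklore] -/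
theorem pinnedChain_sumRule_gibbs {ω₂ lam β γ : ℝ} (hω : 0 < ω₂) (hl : 0 ≤ lam) (hβ : 0 ≤ β) (hγ : 0 ≤ γ)
    (N : ℕ) {T : ℝ} (hT : 0 < T) {S : ℝ} (hS : 0 ≤ S) :
    (∫ z, (pinnedChain ω₂ lam β γ).hamiltonian (N + 1) z * (∫ y, (y.2 (Fin.last N)) ^ 2
        ∂((pinnedChain ω₂ lam β γ).transitionKernel (N + 1) T T S.toNNReal z))
        ∂((pinnedChain ω₂ lam β γ).gibbsMeasure (N + 1) T)) -
      ∫ z, (pinnedChain ω₂ lam β γ).hamiltonian (N + 1) z * (z.2 (Fin.last N)) ^ 2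
        ∂((pinnedChain ω₂ lam β γ).gibbsMeasure (N + 1) T) =
    ∫ s in (0 : ℝ)..S, ∫ z, γ * (2 * T - ((z.2 0) ^ 2 + (z.2 (Fin.last N)) ^ 2)) *
        (∫ y, (y.2 (Fin.last N)) ^ 2 ∂((pinnedChain ω₂ lam β γ).transitionKernel (N + 1) T T s.toNNReal z))
        ∂((pinnedChain ω₂ lam β γ).gibbsMeasure (N + 1) T) := by
  simp_rw [OscillatorChain.integral_gibbsMeasure]
  rw [intervalIntegral.integral_const_mul, ← mul_sub, pinnedChain_sumRule_density hω hl hβ hγ N hT hS]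

/-- **Registered sub-goal `sumRule_energyIdentity`** of crux stmt-AtomisticToContinuum-11812 (under `stub_sumRule`, line
`gibbs-ttcf`): `pinnedChain_sumRule_gibbs` as a closed statement (`ω₂ > 0`, `lam, β, γ ≥ 0`, `T > 0`, `S ≥ 0`). [folklore] -/
theorem sumRule_energyIdentity :
    ∀ ω₂ lam β γ : ℝ, 0 < ω₂ → 0 ≤ lam → 0 ≤ β → 0 ≤ γ → ∀ (N : ℕ) (T : ℝ), 0 < T → ∀ S : ℝ, 0 ≤ S → (∫ z, (pinnedChain ω₂ lam β γ).hamiltonian (N + 1) z * (∫ y, (y.2 (Fin.last N)) ^ 2 ∂((pinnedChain ω₂ lam β γ).transitionKernel (N + 1) T T S.toNNReal z)) ∂((pinnedChain ω₂ lam β γ).gibbsMeasure (N + 1) T)) - (∫ z, (pinnedChain ω₂ lam β γ).hamiltonian (N + 1) z * (z.2 (Fin.last N)) ^ 2 ∂((pinnedChain ω₂ lam β γ).gibbsMeasure (N + 1) T)) = ∫ s in (0 : ℝ)..S, ∫ z, γ * (2 * T - ((z.2 0) ^ 2 + (z.2 (Fin.last N)) ^ 2)) * (∫ y, (y.2 (Fin.last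 N)) ^ 2 ∂((pinnedChain ω₂ lam β γ).transitionKernel (N + 1) T T s.toNNReal z)) ∂((pinnedChain ω₂ lam β γ).gibbsMeasure (N + 1) T) :=
  fun _ _ _ _ hω hl hβ hγ N _ hT _ hS => pinnedChain_sumRule_gibbs hω hl hβ hγ N hT hS

end Summit.AtomisticToContinuum.FouriersLaw.Theorems.BoundaryKubo.GibbsTtcf

end
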